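import Mathlib.CategoryTheory.Whiskering
import Mathlib.CategoryTheory.InducedCategory
import Mathlib.CategoryTheory.Equivalence
import Mathlib.CategoryTheory.EssentialImage
import Mathlib.Analysis.Complex.Circle
import Mathlib.Analysis.SpecialFunctions.Complex.Log
import Mathlib.Analysis.SpecialFunctions.Pow.Continuity
import Mathlib.Topology.Instances.RealVectorSpace
import HarnessLib

/-!
# [AbsTopIII] §5, Remarks 5.10.1–5.10.4 (pp. 149–158): the closing remarks on log-shells

S. Mochizuki, *Topics in Absolute Anabelian Geometry III: Global Reconstruction Algorithms*,
§5 "Global Log-Frobenius Compatibility", Remarks 5.10.1–5.10.4 following Corollary 5.10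
"Fundamental Properties of Log-shells"; locators `p.N` are PDF pages of the author's kurims
manuscript (lit key `paper:url-5493eb38cbb7`, 164 pp.; the journal pagination is not held)
[cite: MochizukiAbsTopIII2015, Rmk 5.10.2 p.149].  Cell abc-iut, layer L4, block W2-B8
(plan/L4/ASSIGNMENTS.md §7); node ids `AbsTopIII:Rmk5.10.1(i)` … `AbsTopIII:Rmk5.10.4` of
plan/L4/NODES.md.  HONEST FRAMING: this file takes no side on [IUTchIII] Cor. 3.12; it types the
mathematical kernels of four REMARKS (most of whose text is interpretive analogy) and PROVES the
elementary ones; nothing here is a reconstruction theorem.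

## Index (Remark → page → status; "record" = interpretive prose, recorded by locator only)

* **5.10.1 (i)** p. 149 — claim: pre-composing the contact homotopy `η⊢_{v,ν}` of Cor. 5.10
  (iv)(c) with the telecore arrow `φ□ : An•[X] → X` of Cor. 5.5 (ii) and applying coricity
  (Cor. 5.5 (i)) and a mono-analyticization homotopy yields a homotopy between the composites
  `An•[X] → An⊢[N⊢⊞] → N⊢⊞_v` and `An•[X] → X → N⊞_v → N⊢⊞_v`.  TYPED AND PROVED in the
  ABSTRACT shape the sentence uses (a "homotopy" between paths of a diagram of categories is a
  natural isomorphism between the composite functors, [AbsTopIII] Def. 3.5 (i) p. 74):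
  `Rmk5101Setting.homotopy` — whiskering of the two given natural isomorphisms.  The concrete
  categories are those of Cor. 5.5 / Cor. 5.10 (abc-iut-L4-t3's `LogFrobeniusSetting`,
  `Cor510MonoContact` in `LogFrobeniusCompatibility.lean`, staged): TODO-import, instantiate
  `Rmk5101Setting` from them in a follow-up once that module is built.
* **5.10.1 (ii)** p. 149 — claim: the category `An•[X, η⊢]` of objects of `An•[X]` "together with
  the algorithms used to construct the various homotopies of (i)" (morphisms = those of `An•[X]`)
  has forgetful functor `An•[X, η⊢] ⥤ An•[X]` "a natural equivalence of categories", and Cor. 5.5,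
  5.10 remain valid with `An•[X, η⊢]` in place of `An•[X]`.  First half TYPED AND PROVED
  abstractly: `WithAlgorithms C A` (objects of `C` decorated by a datum of the nonempty type `A X`,
  morphisms induced) and `forgetAlgorithms_isEquivalence`.  Second half = record (it re-asserts
  Cor. 5.5/5.10 for an equivalent category).
* **5.10.2** pp. 149–154 "the significance of the theory of log-shells … in more intuitive terms"
  — cited ×8 by [IUTchI–III]: (ii) by [IUTchI] pp. 91–93, 101 ("mono-analytic core"; "⊢
  abbreviates mono-analytic", [IUTchI] Rmk. 3.9.1 p. 92); (iii) by [IUTchIII] Rmk. 1.4.1 (ii)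
  p. 46; (iv) by [IUTchII] p. 166 and [IUTchIII] Rmk. 3.6.2 p. 109.
  - (i) p. 150 record (line bundles vs. `MF^∇`-objects; "freezing of integral structures";
    corresponds to panalocalizability Cor. 5.10 (iii)).
  - (ii) p. 151 record (ring structures = "arithmetic holomorphic structures"; log-shells are
    compatible with mono-analyticization, Cor. 5.10 (iv); "mono-analytic core").
  - (iii) pp. 152–153: two elementary kernels PROVED — (a) "`O▷` may be thought of as a product of
    `O^×` with some valuation monoid … in the complex archimedean case `O▷_ℂ ≅ O^×_ℂ × ℝ_{>0}`":
    `Rmk_5_10_2_iii_polar` (the polar decomposition `S¹ × ℝ_{≥0} ≅ O▷_ℂ`, `(u,t) ↦ u·e^{−t}`, a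
    monoid isomorphism onto `{0 < |z| ≤ 1}`; READING NOTE: with `O▷_ℂ` = nonzero elements of
    absolute value `≤ 1` (Def. 4.1 (i) p. 101) the valuation factor is the monoid `ℝ_{≥0}` — the
    printed `ℝ_{>0}` is the valuation factor of `(O▷_ℂ)^{gp} = ℂ^×`); (b) "the logarithm is not a
    ring homomorphism" p. 153: `Rmk_5_10_2_iii_log_not_ringHom`.  The rest ("arithmetic
    Teichmüller dilations", "one must abandon the valuation-monoid portion", "pass freely between
    ⊞ and ⊠ via log", "geometry over `F_1`") is record.
  - (iv) p. 153: "the only subgroups of `F^×` that [if one considers the union with `{0}`] are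
    closed under addition are the subgroups of `F^×` that arise from subfields of `F`" — TYPED AND
    PROVED in the sibling file `AbsTopIII/AdditivelyClosedSubgroups.lean` (`Rmk_5_10_2_iv`, the
    [IUTchIII] Rmk. 3.6.2 uses `Rmk_5_10_2_iv_bot` / `Rmk_5_10_2_iv_SUnits`, and the reading note
    `Rmk_5_10_2_iv_literal_witness`), split off only for the 400-line limit.
  - (v) p. 153 record (cf. [EtTh] Rmk. 1.10.4); (vi) p. 154 record (log-shells ↔ section
    determined by the `p`-curvature).
* **5.10.3** pp. 154–158 — (i) record (number field ↔ hyperbolic curve in positive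
  characteristic, once-punctured elliptic curve ↔ nilpotent indigenous bundle; "anabelian, not
  `sl₂`-theoretic"); (ii) record (crystalline theta object; Belyi vs. elliptic cuspidalization ↔
  Verschiebung vs. Frobenius on square differentials); (iii) record (units = positive slope,
  valuation monoid = slope zero); (iv) record (moduli of once-punctured elliptic curves is
  one-dimensional); (v) pp. 157–158: elementary kernel PROVED — "the quadratic correspondence
  `ℤ ∋ n ↦ n² ∈ ℤ` is [unlike the linear correspondence `n ↦ c·n`, for `c ∈ ℤ`] bounded from
  below": `Rmk_5_10_3_v_sq_bddBelow`, `Rmk_5_10_3_v_linear_not_bddBelow` (for `c ≠ 0`; for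
  `c = 0` the linear map is constant, hence bounded — noted); the rest of (v) is record;
  (vi) p. 158 record: "Siegel's classical finiteness theorem [which implies the finiteness of the
  set of isomorphism classes of elliptic curves over a given log number field]" = Shafarevich's
  theorem (Silverman, AEC IX.6.1) — a theorem about elliptic curves over number fields, NOT typed
  in this anabelian-geometry file (belongs under `Literature/NumberTheory/EllipticCurves`).
* **5.10.4** p. 158 — record ([AbsTopII] §2 as a `p`-adic analogue of the lemma of Uchida,
  Prop. 1.3; cf. `AbsTopIII.Prop_1_3` in `LinearSystems`).

Deliberately NOT here: Cor. 5.5, Def. 5.9, Cor. 5.10 themselves (abc-iut-L4-t3), the diagram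
vocabulary of Def. 3.5 (abc-iut-L4-t2, `DiagramsOfCategories`), `O▷_ℂ` as a named monoid
(t3's `complexIntegralMonoid`, `MonoAnalyticLogShells`); this file only proves statements ABOUT
the set `{z | z ≠ 0 ∧ ‖z‖ ≤ 1}` and never re-declares those notions.
-/

noncomputable section

open scoped Classical

namespace Literature.AnabelianGeometry.AbsoluteAnabelian.AbsTopIII

open CategoryTheory

/-! ### Remark 5.10.1 (i), p. 149 — pre-composition with the telecore arrow -/

section Rmk5101

universe v₁ v₂ v₃ v₄ v₅ u₁ u₂ u₃ u₄ u₅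

variable (AnX : Type u₁) [Category.{v₁} AnX] (X : Type u₂) [Category.{v₂} X]
  (N : Type u₃) [Category.{v₃} N] (M : Type u₄) [Category.{v₄} M] (B : Type u₅) [Category.{v₅} B]

/-- The ABSTRACT data Remark 5.10.1 (i) manipulates (Def. 3.5 (i): a homotopy between two paths
of a diagram of categories is a natural isomorphism between the composite functors).  Vertices:
`AnX = An•[X]`, `X`, `N = N⊞_v`, `M = N⊢⊞_v`, `B = An⊢[N⊢⊞]`.  Arrows: `tele = φ□ : An•[X] → X`
(the telecore arrow of Cor. 5.5 (ii)), `lam = λ⊞_{v,ν} : X → N⊞_v`, `mono : N⊞_v → N⊢⊞_v`,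
`long : X → An⊢[N⊢⊞]` (the composite `X → N⊞_v → N_v → E• → E⊢ → An⊢[N⊢⊞]` of the path
`γ¹_{v,ν}` of Cor. 5.10 (iv)(c) p. 148, up to its last arrow), `psi = φ^{An⊢⊞}_{v,ν}`,
`direct : An•[X] → An⊢[N⊢⊞]` (the arrow of `D•⊢` of Cor. 5.10 p. 146).  Homotopies GIVEN:
`eta : long ⋙ psi ≅ lam ⋙ mono` (= `η⊢_{v,ν}` of Cor. 5.10 (iv)(c)) and
`coric : tele ⋙ long ≅ direct` ("applying the coricity of Corollary 5.5, (i), together with an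
appropriate mono-analyticization homotopy").  TODO-import abc-iut-L4-t3: instantiate from
`LogFrobeniusSetting` / `Cor55Cores` / `Cor55Telecore` / `Cor510MonoContact` of
`AbsoluteAnabelian/LogFrobeniusCompatibility.lean` (staged, not yet filed) once it is built.
[cite: MochizukiAbsTopIII2015, Rmk 5.10.1 (i) p.149] -/
structure Rmk5101Setting where
  /-- `φ□ : An•[X] → X`, the telecore arrow of Cor. 5.5 (ii). -/
  tele : AnX ⥤ X
  /-- `λ⊞_{v,ν} : X → N⊞_v`. -/
  lam : X ⥤ N
  /-- the arrow `N⊞_v → N⊢⊞_v` of the mono-analyticization morphism. -/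
  mono : N ⥤ M
  /-- the composite `X → N⊞_v → N_v → E• → E⊢ → An⊢[N⊢⊞]` (first five arrows of `γ¹_{v,ν}`). -/
  long : X ⥤ B
  /-- `φ^{An⊢⊞}_{v,ν} : An⊢[N⊢⊞] → N⊢⊞_v`. -/
  psi : B ⥤ M
  /-- the arrow `An•[X] → An⊢[N⊢⊞]` of the glued diagram `D•⊢`. -/
  direct : AnX ⥤ B
  /-- `η⊢_{v,ν}` (Cor. 5.10 (iv)(c)): a homotopy from the path `γ¹_{v,ν}` to `γ⁰_{v,ν}`. -/
  eta : long ⋙ psi ≅ lam ⋙ mono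
  /-- coricity of Cor. 5.5 (i) composed with a mono-analyticization homotopy. -/
  coric : tele ⋙ long ≅ direct

variable {AnX X N M B}

/-- Remark 5.10.1 (i), PROVED in the abstract shape: "by pre-composing `η⊢_{v,ν}` with the
telecore arrow `φ□` … and applying the coricity … we obtain … a homotopy from the path
`An•[X] → An⊢[N⊢⊞] → N⊢⊞_v` … to the path `An•[X] → X → N⊞_v → N⊢⊞_v` [i.e., obtained by simply
pre-composing `γ⁰_{v,ν}` with `φ□`]". [cite: MochizukiAbsTopIII2015, Rmk 5.10.1 (i) p.149] -/
def Rmk5101Setting.homotopy (S : Rmk5101Setting AnX X N M B) :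
    S.direct ⋙ S.psi ≅ S.tele ⋙ (S.lam ⋙ S.mono) :=
  Functor.isoWhiskerRight S.coric.symm S.psi ≪≫ Functor.associator S.tele S.long S.psi ≪≫
    Functor.isoWhiskerLeft S.tele S.eta

end Rmk5101

/-! ### Remark 5.10.1 (ii), p. 149 — decorating objects by canonical algorithms -/

section Rmk5101ii

universe w v u

variable (C : Type u) [Category.{v} C] (A : C → Type w)

/-- The category "`An•[X, η⊢]`"-style construction of Remark 5.10.1 (ii): objects are objects
`Y` of `C` "together with" a datum of type `A Y` ("the algorithms used to construct the various
homotopies of (i)"), and "morphisms are the morphisms induced by morphisms of" `C` (Mathlib's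
`InducedCategory` along the first projection). [cite: MochizukiAbsTopIII2015, Rmk 5.10.1 (ii) p.149] -/
abbrev WithAlgorithms : Type (max u w) :=
  InducedCategory C (Sigma.fst : (Σ Y : C, A Y) → C)

/-- The "forgetful functor" `An•[X, η⊢] → An•[X]` of Remark 5.10.1 (ii).
[cite: MochizukiAbsTopIII2015, Rmk 5.10.1 (ii) p.149] -/
abbrev forgetAlgorithms : WithAlgorithms C A ⥤ C :=
  inducedFunctor (Sigma.fst : (Σ Y : C, A Y) → C)

variable {C A}

/-- Remark 5.10.1 (ii), first half, PROVED abstractly: when every object carries at least one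
datum (in the text: the algorithms EXIST, being "group-theoretic algorithms encoding the
reciprocity law of local class field theory …"), "the forgetful functor `An•[X, η⊢] ⥲ An•[X]`
determines a natural equivalence of categories" (it is fully faithful by construction and
surjective on objects). [cite: MochizukiAbsTopIII2015, Rmk 5.10.1 (ii) p.149] -/
theorem forgetAlgorithms_isEquivalence (hA : ∀ Y : C, Nonempty (A Y)) :
    (forgetAlgorithms C A).IsEquivalence where
  essSurj := Functor.essSurj_of_surj fun Y => ⟨⟨Y, (hA Y).some⟩, rfl⟩

end Rmk5101ii

/-! ### Remark 5.10.2 (iii), pp. 152–153 — `O▷_ℂ` as units times a valuation monoid -/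

section Rmk5102iii

open Complex

/-- The polar-coordinate monoid homomorphism `S¹ × (ℝ_{≥0}, +) → (ℂ, ·)`, `(u, t) ↦ u · e^{−t}`
(the additive monoid `ℝ_{≥0}` written multiplicatively), used to state Remark 5.10.2 (iii)'s
"`O▷` may be thought of as a [possibly twisted] product of `O^×` with some valuation monoid".
[cite: MochizukiAbsTopIII2015, Rmk 5.10.2 (iii) p.152] -/
def polarHom : Circle × Multiplicative NNReal →* ℂ where
  toFun p := (p.1 : ℂ) * (Real.exp (-(p.2.toAdd : ℝ)) : ℝ)
  map_one' := by simp
  map_mul' p q := by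
    simp only [Prod.fst_mul, Prod.snd_mul, Circle.coe_mul, toAdd_mul, NNReal.coe_add, neg_add,
      Real.exp_add, ofReal_mul]
    ring

/-- `polarHom (u, t) = u · e^{−t}`. [cite: MochizukiAbsTopIII2015, Rmk 5.10.2 (iii) p.152] -/
@[simp] theorem polarHom_apply (u : Circle) (t : Multiplicative NNReal) :
    polarHom (u, t) = (u : ℂ) * (Real.exp (-(t.toAdd : ℝ)) : ℝ) := rfl

/-- `|u · e^{−t}| = e^{−t}`: the valuation coordinate is read off from the absolute value.
[cite: MochizukiAbsTopIII2015, Rmk 5.10.2 (iii) p.152] -/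
theorem norm_polarHom (u : Circle) (t : Multiplicative NNReal) :
    ‖polarHom (u, t)‖ = Real.exp (-(t.toAdd : ℝ)) := by
  rw [polarHom_apply, norm_mul, Circle.norm_coe, one_mul, norm_real, Real.norm_eq_abs,
    abs_of_pos (Real.exp_pos _)]

/-- Remark 5.10.2 (iii), the complex archimedean instance, PROVED: polar coordinates identify
`O^×_ℂ × (valuation monoid) = S¹ × ℝ_{≥0}` with `O▷_ℂ = {z ∈ ℂ | z ≠ 0, |z| ≤ 1}` (Def. 4.1 (i)
p. 101: `O_ℂ` = elements of absolute value `≤ 1`, `O▷_ℂ` its nonzero elements) — `polarHom` is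
injective with image exactly `O▷_ℂ`.  (Printed: "`O▷_ℂ ≅ O^×_ℂ × ℝ_{>0}`"; see the module
docstring's reading note.) [cite: MochizukiAbsTopIII2015, Rmk 5.10.2 (iii) p.152] -/
theorem Rmk_5_10_2_iii_polar :
    Function.Injective polarHom ∧
      Set.range polarHom = {z : ℂ | z ≠ 0 ∧ ‖z‖ ≤ 1} := by
  constructor
  · rintro ⟨u, t⟩ ⟨u', t'⟩ h
    have hn := congrArg (fun z : ℂ => ‖z‖) h
    simp only [norm_polarHom, Real.exp_eq_exp, neg_inj, NNReal.coe_inj] at hn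
    have ht : t = t' := Multiplicative.toAdd.injective hn
    subst ht
    have hne : ((Real.exp (-(t.toAdd : ℝ)) : ℝ) : ℂ) ≠ 0 :=
      ofReal_ne_zero.mpr (Real.exp_pos _).ne'
    have hu : (u : ℂ) = u' := mul_right_cancel₀ hne (by simpa only [polarHom_apply] using h)
    rw [Circle.ext hu]
  · ext z
    simp only [Set.mem_range, Set.mem_setOf_eq, Prod.exists]
    constructor
    · rintro ⟨u, t, rfl⟩
      refine ⟨?_, ?_⟩
      · rw [← norm_ne_zero_iff, norm_polarHom]
        exact (Real.exp_pos _).ne'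
      · rw [norm_polarHom, Real.exp_le_one_iff, neg_nonpos]
        exact t.toAdd.2
    · rintro ⟨hz, hz1⟩
      have hpos : 0 < ‖z‖ := norm_pos_iff.mpr hz
      let t : NNReal := ⟨-Real.log ‖z‖, neg_nonneg.mpr (Real.log_nonpos hpos.le hz1)⟩
      have ht : Real.exp (-(t : ℝ)) = ‖z‖ := by
        show Real.exp (-(-Real.log ‖z‖)) = ‖z‖
        rw [neg_neg, Real.exp_log hpos]
      have hu1 : ‖((‖z‖⁻¹ : ℝ) : ℂ) * z‖ = 1 := by
        rw [norm_mul, norm_real, Real.norm_eq_abs, abs_of_pos (inv_pos.mpr hpos),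
          inv_mul_cancel₀ hpos.ne']
      let u : Circle := ⟨((‖z‖⁻¹ : ℝ) : ℂ) * z, mem_sphere_zero_iff_norm.2 hu1⟩
      refine ⟨u, Multiplicative.ofAdd t, ?_⟩
      rw [polarHom_apply, toAdd_ofAdd, ht]
      show ((‖z‖⁻¹ : ℝ) : ℂ) * z * ((‖z‖ : ℝ) : ℂ) = z
      rw [mul_comm ((‖z‖⁻¹ : ℝ) : ℂ) z, mul_assoc, ← ofReal_mul, inv_mul_cancel₀ hpos.ne',
        ofReal_one, mul_one]

/-- Remark 5.10.2 (iii) p. 153, PROVED for the complex logarithm: "since the logarithm is not a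
ring homomorphism …" — there is no ring homomorphism `ℂ →+* ℂ` that agrees with `Complex.log`
(a ring homomorphism sends `1` to `1`, whereas `log 1 = 0`).
[cite: MochizukiAbsTopIII2015, Rmk 5.10.2 (iii) p.153] -/
theorem Rmk_5_10_2_iii_log_not_ringHom : ¬ ∃ f : ℂ →+* ℂ, ∀ z, f z = Complex.log z := by
  rintro ⟨f, hf⟩
  have h := hf 1
  rw [map_one, Complex.log_one] at h
  exact one_ne_zero h

end Rmk5102iii


/-! ### Remark 5.10.3 (v), pp. 157–158 — quadratic versus linear correspondences on `ℤ` -/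

/-- Remark 5.10.3 (v) p. 157, PROVED: "this quadratic correspondence `ℤ ∋ n ↦ n² ∈ ℤ` is …
bounded from below". [cite: MochizukiAbsTopIII2015, Rmk 5.10.3 (v) p.157] -/
theorem Rmk_5_10_3_v_sq_bddBelow : BddBelow (Set.range fun n : ℤ => n ^ 2) :=
  ⟨0, by rintro _ ⟨n, rfl⟩; positivity⟩

/-- Remark 5.10.3 (v) p. 157, PROVED: "[unlike the linear correspondence `n ↦ c · n`, for
`c ∈ ℤ`]" — for `c ≠ 0` the linear map is NOT bounded from below (for `c = 0` it is constant,
hence bounded; the text's contrast concerns nonzero `c`). [cite: MochizukiAbsTopIII2015, Rmk 5.10.3 (v) p.157] -/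
theorem Rmk_5_10_3_v_linear_not_bddBelow (c : ℤ) (hc : c ≠ 0) :
    ¬ BddBelow (Set.range fun n : ℤ => c * n) := by
  rintro ⟨b, hb⟩
  rw [mem_lowerBounds] at hb
  have key : ∀ n : ℤ, b ≤ c * n := fun n => hb _ ⟨n, rfl⟩
  rcases lt_or_gt_of_ne hc with h | h
  · have := key (|b| + 1)
    nlinarith [abs_nonneg b, le_abs_self b, neg_abs_le b]
  · have := key (-(|b| + 1))
    nlinarith [abs_nonneg b, le_abs_self b, neg_abs_le b]


/-! ### Remark 5.10.2 (iii), p. 152 — "dilations of `ℝ_{>0}` [by raising to the `λ`-th power]" (appended) -/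

/-- Remark 5.10.2 (iii) p. 152, PROVED: "the resulting dilations of `ℝ_{>0}` [i.e., by raising to
the `λ`-th power, for `λ ∈ ℝ_{>0}`]" — every continuous multiplicative self-map of the valuation
monoid `(ℝ_{>0}, ·)` is a dilation `t ↦ t^λ` for a unique real `λ` (here: existence of `λ`; the
map is `log ∘ φ ∘ exp`, a continuous additive endomorphism of `ℝ`, hence linear).
[cite: MochizukiAbsTopIII2015, Rmk 5.10.2 (iii) p.152] -/
theorem Rmk_5_10_2_iii_dilations (φ : ℝ → ℝ) (hcont : ContinuousOn φ (Set.Ioi 0))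
    (hpos : ∀ x, 0 < x → 0 < φ x) (hmul : ∀ x y, 0 < x → 0 < y → φ (x * y) = φ x * φ y) :
    ∃ c : ℝ, ∀ x, 0 < x → φ x = x ^ c := by
  -- `ψ = log ∘ φ ∘ exp` is a continuous additive map `ℝ → ℝ`
  let ψ : ℝ →+ ℝ :=
    { toFun := fun t => Real.log (φ (Real.exp t))
      map_zero' := by
        have h1 : φ 1 = 1 := by
          have h := hmul 1 1 one_pos one_pos
          rw [one_mul] at h
          -- φ 1 = φ 1 * φ 1 with φ 1 > 0
          have hp := hpos 1 one_pos
          nlinarith [hp]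
        simp [h1]
      map_add' := fun s t => by
        simp only [Real.exp_add]
        rw [hmul _ _ (Real.exp_pos s) (Real.exp_pos t),
          Real.log_mul (hpos _ (Real.exp_pos s)).ne' (hpos _ (Real.exp_pos t)).ne'] }
  have hψc : Continuous ψ := by
    show Continuous fun t => Real.log (φ (Real.exp t))
    have h1 : Continuous fun t => φ (Real.exp t) :=
      hcont.comp_continuous Real.continuous_exp fun t => Real.exp_pos t
    exact Continuous.log h1 fun t => (hpos _ (Real.exp_pos t)).ne'
  refine ⟨ψ 1, fun x hx => ?_⟩
  have hlin : ψ (Real.log x) = Real.log x * ψ 1 := by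
    have h := map_real_smul ψ hψc (Real.log x) 1
    simp only [smul_eq_mul, mul_one] at h
    exact h
  have hψx : ψ (Real.log x) = Real.log (φ x) := by
    show Real.log (φ (Real.exp (Real.log x))) = Real.log (φ x)
    rw [Real.exp_log hx]
  rw [Real.rpow_def_of_pos hx, ← hlin, hψx, Real.exp_log (hpos x hx)]

/-- Converse direction of `Rmk_5_10_2_iii_dilations`: each dilation `t ↦ t^λ` is a continuous
multiplicative self-map of `ℝ_{>0}`. [cite: MochizukiAbsTopIII2015, Rmk 5.10.2 (iii) p.152] -/
theorem Rmk_5_10_2_iii_rpow_isDilation (c : ℝ) :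
    ContinuousOn (fun x : ℝ => x ^ c) (Set.Ioi 0) ∧ (∀ x : ℝ, 0 < x → 0 < x ^ c) ∧
      ∀ x y : ℝ, 0 < x → 0 < y → (x * y) ^ c = x ^ c * y ^ c :=
  ⟨fun x hx => (Real.continuousAt_rpow_const x c (Or.inl (ne_of_gt hx))).continuousWithinAt,
    fun _ hx => Real.rpow_pos_of_pos hx c,
    fun _ _ hx hy => Real.mul_rpow hx.le hy.le⟩

end Literature.AnabelianGeometry.AbsoluteAnabelian.AbsTopIII
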